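import Mathlib.Algebra.Homology.Embedding.Extend
import Mathlib.Algebra.Homology.Additive
import Mathlib.CategoryTheory.Limits.Preserves.Shapes.Zero
import HarnessLib

/-!
# Functors commute with `HomologicalComplex.extend`: `F(K.extend e) ≅ (F K).extend e`

For a functor `F : C ⥤ D` preserving zero morphisms (between categories with zero morphisms and a
zero object), a complex `K : HomologicalComplex C c` and an embedding of complex shapes
`e : c.Embedding c'`, the extended complex `K.extend e` (Mathlib: `K` placed on the image of `e`,
zero elsewhere) satisfies `F(K.extend e) ≅ (F K).extend e` (`mapExtendIso`), componentwise the
identity on the image of `e` and `F 0 ≅ 0` elsewhere. Not in Mathlib (which has `extendMap`,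
`extendSingleIso`, `extendOpIso` but no compatibility with `Functor.mapHomologicalComplex`).

## References

Folklore (C. Weibel, *An introduction to homological algebra*, 1.2: functors act termwise on
complexes). [folklore]
-/

open CategoryTheory Limits

namespace Literature.Algebra.Homology

variable {ι ι' : Type*} {c : ComplexShape ι} {c' : ComplexShape ι'} {C D : Type*} [Category C]
  [Category D] [HasZeroMorphisms C] [HasZeroObject C] [HasZeroMorphisms D] [HasZeroObject D]
  (F : C ⥤ D) [F.PreservesZeroMorphisms] (K : HomologicalComplex C c) (e : c.Embedding c')

/-- Componentwise isomorphisms `F (extend.X K i) ≅ extend.X (F K) i` (identity on the image of the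
embedding, `F 0 ≅ 0` outside). [folklore] -/
noncomputable def mapExtendXIso : ∀ (i : Option ι),
    F.obj (HomologicalComplex.extend.X K i) ≅
      HomologicalComplex.extend.X ((F.mapHomologicalComplex c).obj K) i
  | some _ => Iso.refl _
  | none => F.mapZeroObject

/-- The componentwise isomorphisms commute with the differentials. [folklore] -/
theorem mapExtendXIso_d (i j : Option ι) :
    F.map (HomologicalComplex.extend.d K i j) ≫ (mapExtendXIso F K j).hom =
      (mapExtendXIso F K i).hom ≫
        HomologicalComplex.extend.d ((F.mapHomologicalComplex c).obj K) i j := by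
  rcases i with _ | a
  · rw [HomologicalComplex.extend.d_none_eq_zero _ _ _ rfl,
      HomologicalComplex.extend.d_none_eq_zero _ _ _ rfl, F.map_zero, zero_comp, comp_zero]
  rcases j with _ | b
  · rw [HomologicalComplex.extend.d_none_eq_zero' _ _ _ rfl,
      HomologicalComplex.extend.d_none_eq_zero' _ _ _ rfl, F.map_zero, zero_comp, comp_zero]
  · change F.map (K.d a b) ≫ 𝟙 _ = 𝟙 _ ≫ ((F.mapHomologicalComplex c).obj K).d a b
    rw [Category.comp_id, Category.id_comp, Functor.mapHomologicalComplex_obj_d]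

/-- **A functor preserving zero morphisms commutes with the extension of complexes along an
embedding of complex shapes**: `F(K.extend e) ≅ (F K).extend e` (e.g. `F(K^{ℕ→ℤ}) ≅ (F K)^{ℕ→ℤ}`
for `e = embeddingUpNat`). [folklore] -/
noncomputable def mapExtendIso :
    (F.mapHomologicalComplex c').obj (K.extend e) ≅ ((F.mapHomologicalComplex c).obj K).extend e :=
  HomologicalComplex.Hom.isoOfComponents (fun i' => mapExtendXIso F K (e.r i'))
    (fun i' j' _ => (mapExtendXIso_d F K (e.r i') (e.r j')).symm)

end Literature.Algebra.Homology
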